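import Literature.AnabelianGeometry.SemiGraphs.TemperedReconstructionCompatProofs
import Literature.AnabelianGeometry.SemiGraphs.TemperedReconstructionReductionsProofsAt
import Literature.AnabelianGeometry.SemiGraphs.TemperedReconstructionBaseUniquenessProofs
import Literature.AnabelianGeometry.SemiGraphs.TemperedThm37OfCompactInVerticialAt
import HarnessLib

/-!
# Corollary 3.9 over the compatible reading: reduction to its steps — AT ONE PAIR OF GRAPHS (φ2 twin)

Mochizuki, *Semi-graphs of anabelioids*, Publ. RIMS **42** (2006), §3, Cor. 3.9, proof pp. 42–43
[cite: MochizukiSemiAnbd2006, Cor 3.9 pp.42-43].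

Companion of `TemperedReconstructionCompatProofs.lean` (abc-iut-L3-t2) under the cell's φ2-consumers
programme (rulings φ2 / α4-3 / α5-3 of abc-iut-L3-lead): `cor39Compat_of_steps` /
`cor39Compat_of_thm37_i_iii` re-proved AT ONE PAIR `(𝒢, ℋ)` with charts `(c𝒢, cℋ)`, with the
per-graph hypotheses `(h𝒢iii : CompactInVerticialAt 𝒢)`, `(hℋiii : CompactInVerticialAt ℋ)`
(abc-iut-w4-d075) in place of the ∀-countable named fact `CompactInVerticial`.  `Cor39Compat` has no
per-pair name, so the conclusion is its BODY at the pair; the step hypotheses R2′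
(`QuasiGeometricGraphDataCompat`) and R3 (`InducesOfCompatible`, chosen conjugators — the open input of
this reading, cell finding d080-F2) are taken AT THE PAIR (`hR2`, `hR3`, inline), so that the
per-pair R2′ of abc-iut-w4-d083 (`…R2bCompatProofsAt`) plugs in by name.  (iii) enters only through
Thm. 3.7 (iv) at both graphs (R0, abc-iut-L3-d1's `InducedIsQuasiGeometric_of_at`); R1 is
`InducesCompatible_holds`, R4 is abc-iut-w4-d083's UNCONDITIONAL `compatibleEdgeMapUnique_holds`.
Proof-only; the original file is untouched.  Nothing here takes a side on [IUTchIII] Cor. 3.12;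
typed ≠ discharged.
-/

namespace Literature.AnabelianGeometry.SemiGraphs

namespace ProfiniteSemiGraph

universe u

variable {𝒢 ℋ : ProfiniteSemiGraph.{u}}

/-- **`Cor39Compat` at the pair `(G, H)` from its steps at the pair** (per-pair form of
`cor39Compat_of_steps`): (a) = R1 ≫ R0 (Thm. 3.7 (iv) AT `𝒢` and AT `ℋ`); (b)-existence = R2′ ≫ R3
(per-pair inputs); (b)-uniqueness = R1 ×2 + `compatible_vertexMap_eq` + R4 (unconditional).
[cite: MochizukiSemiAnbd2006, Cor 3.9 pp.42-43] -/
theorem cor39Compat_of_stepsAt (h37i : VerticialInjective.{u})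
    (h37iv𝒢 : MaximalCompactIffVerticialAt 𝒢) (h37ivℋ : MaximalCompactIffVerticialAt ℋ)
    (h𝒢 : Cor39Hypotheses 𝒢) (hℋ : Cor39Hypotheses ℋ) (c𝒢 : TemperedPiChart 𝒢) (cℋ : TemperedPiChart ℋ)
    (hR2 : ∀ φ : c𝒢.G →ₜ* cℋ.G, IsCompatiblyQuasiGeometric φ →
      ∃ F : Hom 𝒢 ℋ, F.IsLocallyOpen ∧ F.CompatV c𝒢 cℋ φ ∧ F.CompatE c𝒢 cℋ φ)
    (hR3 : ∀ (F : Hom 𝒢 ℋ) (φ : c𝒢.G →ₜ* cℋ.G), F.IsLocallyOpen → F.CompatV c𝒢 cℋ φ →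
      F.CompatE c𝒢 cℋ φ → F.Induces c𝒢 cℋ φ) :
    (∀ (F : Hom 𝒢 ℋ), F.IsLocallyOpen → ∀ φ : c𝒢.G →ₜ* cℋ.G, F.Induces c𝒢 cℋ φ →
        IsQuasiGeometric φ) ∧
      ∀ φ : c𝒢.G →ₜ* cℋ.G, IsCompatiblyQuasiGeometric φ →
        ∃ F : Hom 𝒢 ℋ, F.IsLocallyOpen ∧ F.Induces c𝒢 cℋ φ ∧
          ∀ F' : Hom 𝒢 ℋ, F'.IsLocallyOpen → F'.Induces c𝒢 cℋ φ →
            F'.base.vertexMap = F.base.vertexMap ∧ F'.base.edgeMap = F.base.edgeMap := by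
  refine ⟨fun F hF φ hind => ?_, fun φ hφ => ?_⟩
  · obtain ⟨hV, hE⟩ := InducesCompatible_holds 𝒢 ℋ h𝒢 hℋ c𝒢 cℋ F φ hind
    exact InducedIsQuasiGeometric_of_at h37i h37iv𝒢 h37ivℋ h𝒢 hℋ c𝒢 cℋ F φ hF hV hE
  · obtain ⟨F, hF, hV, hE⟩ := hR2 φ hφ
    refine ⟨F, hF, hR3 F φ hF hV hE, fun F' hF' hind' => ?_⟩
    obtain ⟨hV', hE'⟩ := InducesCompatible_holds 𝒢 ℋ h𝒢 hℋ c𝒢 cℋ F' φ hind'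
    have hv : F'.base.vertexMap = F.base.vertexMap :=
      compatible_vertexMap_eq h37i verticialDistinct_holds h𝒢 hℋ c𝒢 cℋ hF' hV' hV
    exact ⟨hv, compatibleEdgeMapUnique_holds 𝒢 ℋ h𝒢 hℋ c𝒢 cℋ F' F φ hF' hF hV' hE' hV hE hv⟩

/-- **`Cor39Compat` at the pair `(G, H)` from Thm. 3.7 (i), (iii) AT `𝒢` AND AT `ℋ`, the twin step
R2′ and R3 at the pair** — per-pair form of `cor39Compat_of_thm37_i_iii`.
[cite: MochizukiSemiAnbd2006, Cor 3.9 pp.42-43] -/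
theorem cor39Compat_of_thm37_i_iiiAt (h37i : VerticialInjective.{u}) (h𝒢iii : CompactInVerticialAt 𝒢)
    (hℋiii : CompactInVerticialAt ℋ) (h𝒢 : Cor39Hypotheses 𝒢) (hℋ : Cor39Hypotheses ℋ)
    (c𝒢 : TemperedPiChart 𝒢) (cℋ : TemperedPiChart ℋ)
    (hR2 : ∀ φ : c𝒢.G →ₜ* cℋ.G, IsCompatiblyQuasiGeometric φ →
      ∃ F : Hom 𝒢 ℋ, F.IsLocallyOpen ∧ F.CompatV c𝒢 cℋ φ ∧ F.CompatE c𝒢 cℋ φ)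
    (hR3 : ∀ (F : Hom 𝒢 ℋ) (φ : c𝒢.G →ₜ* cℋ.G), F.IsLocallyOpen → F.CompatV c𝒢 cℋ φ →
      F.CompatE c𝒢 cℋ φ → F.Induces c𝒢 cℋ φ) :
    (∀ (F : Hom 𝒢 ℋ), F.IsLocallyOpen → ∀ φ : c𝒢.G →ₜ* cℋ.G, F.Induces c𝒢 cℋ φ →
        IsQuasiGeometric φ) ∧
      ∀ φ : c𝒢.G →ₜ* cℋ.G, IsCompatiblyQuasiGeometric φ →
        ∃ F : Hom 𝒢 ℋ, F.IsLocallyOpen ∧ F.Induces c𝒢 cℋ φ ∧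
          ∀ F' : Hom 𝒢 ℋ, F'.IsLocallyOpen → F'.Induces c𝒢 cℋ φ →
            F'.base.vertexMap = F.base.vertexMap ∧ F'.base.edgeMap = F.base.edgeMap :=
  cor39Compat_of_stepsAt h37i (maximalCompactIffVerticialAt_of_compactInVerticialAt h𝒢iii)
    (maximalCompactIffVerticialAt_of_compactInVerticialAt hℋiii) h𝒢 hℋ c𝒢 cℋ hR2 hR3

/-- The ∀-countable original specialises to the per-pair form: the frozen twin `Cor39Compat` follows
from Thm. 3.7 (i), `CompactInVerticialAt` at every graph, R2′ and R3 (sanity link to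
`cor39Compat_of_thm37_i_iii`). [cite: MochizukiSemiAnbd2006, Cor 3.9 pp.42-43] -/
theorem cor39Compat_of_forall_compactInVerticialAt (h37i : VerticialInjective.{u})
    (hiii : ∀ 𝒢 : ProfiniteSemiGraph.{u}, CompactInVerticialAt 𝒢)
    (hR2 : QuasiGeometricGraphDataCompat.{u}) (hR3 : InducesOfCompatible.{u}) : Cor39Compat.{u} :=
  fun 𝒢 ℋ h𝒢 hℋ c𝒢 cℋ =>
    cor39Compat_of_thm37_i_iiiAt h37i (hiii 𝒢) (hiii ℋ) h𝒢 hℋ c𝒢 cℋ (hR2 𝒢 ℋ h𝒢 hℋ c𝒢 cℋ)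
      (hR3 𝒢 ℋ h𝒢 hℋ c𝒢 cℋ)

end ProfiniteSemiGraph

end Literature.AnabelianGeometry.SemiGraphs
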